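import Literature.NumberTheory.LFunctions.SelbergDeltaOffLine
import Literature.NumberTheory.LFunctions.SelbergDeltaNearSum
import Literature.NumberTheory.LFunctions.SelbergDeltaPrimeSide
import Literature.NumberTheory.LFunctions.SelbergFujiiSmallGaps
import HarnessLib

/-!
# Selberg's bound `∫_T^{2T} |S(t+h) − S(t)| dt ≫ T` and the small gaps between zeta zeros

Topic `Literature/NumberTheory/LFunctions`. Everything in this file is PROVED.

We assemble Selberg's lower bound for the first absolute moment of `S(t+h) − S(t)`,
`h ≍ M/log T` (Titchmarsh §9.26, the input `hS` of
`Literature.NumberTheory.LFunctions.selberg_fujii_small_gaps_of_abs_moment`), from the `L¹` theory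
of the smoothed `S(t+h) − S(t)` developed in `SelbergDelta*`:

* `SelbergDeltaAssembly.main_pointwise`: the explicit formula for the dilated Rudnick–Sarnak test
  function, integrated in `t` over `[u, u+h]`, bounds the prime side `|Re(𝒱_τ(u+h) − 𝒱_τ(u))|` by
  the smoothed `|S(t+h) − S(t)|`, the off-line zero terms and small remainders;
* `SelbergDeltaSSide.integral_abs_conv_le` (Young): the smoothed term integrates to at most
  `2π g₀(0) ∫_T^{2T} |S(t+h) − S(t)| dt`;
* `SelbergDeltaOffLine.exists_offLine_L1_bound` with the density input
  `SelbergDeltaNearSum.nearSum_le_linear` (Selberg's density theorem near the line): the off-line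
  terms are `O(T)` in `L¹`, uniformly in the shift;
* `SelbergDeltaPrimeSide.primeSide_lower`: the prime side is `≫ T √(log M)` in `L¹`.

Choosing the shift scale `M` large gives `abs_moment_deltaS_lower`, and with the reduction already
in the tree, `selberg_fujii_small_gaps_holds`: a positive proportion of consecutive ordinates of
the zeros of `ζ` are closer than `μ < 1` times the average spacing (Titchmarsh (9.25.6)).

## References

* E. C. Titchmarsh, *The Theory of the Riemann Zeta-Function*, 2nd ed. (1986), §9.25–9.26.
  [cite: Titchmarsh1986, §9.26]
* A. Selberg, *Contributions to the theory of the Riemann zeta-function* (1946), Thm. 1, §7.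
* A. Fujii, *On the difference between `r` consecutive ordinates of the zeros of the Riemann zeta
  function*, Proc. Japan Acad. 51 (1975), 741–743.
-/

noncomputable section

open Complex Real MeasureTheory Set Filter Finset intervalIntegral
open scoped Topology

namespace Literature.NumberTheory.LFunctions.SelbergDelta

open Literature.NumberTheory.LFunctions.SelbergOmega
open Literature.NumberTheory.LFunctions.RudnickSarnakN
open Literature.NumberTheory.LFunctions.ZeroOrdinateSums

/-! ### Continuity of the off-line term in `u` -/

/-- `1/(1+(γ−s)²) ≤ 2(1+s²)/(1+γ²)`. [folklore] -/
theorem inv_one_add_sub_sq_le (γ s : ℝ) : 1 / (1 + (γ - s) ^ 2) ≤ 2 * (1 + s ^ 2) / (1 + γ ^ 2) := by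
  rw [div_le_div_iff₀ (by positivity) (by positivity)]
  nlinarith [sq_nonneg (γ - 2 * s), sq_nonneg ((γ - s) * s), sq_nonneg (γ - s - s)]

/-- The off-line term `u ↦ ∑_ρ m(ρ)(𝒜_ρ(u+h) − 𝒜_ρ(u))` is continuous on compact `u`-ranges
(`τ ≥ 1`). [folklore] -/
theorem continuousOn_offLine {τ : ℝ} (hτ : 1 ≤ τ) (h a b : ℝ) :
    ContinuousOn (fun u : ℝ => ∑' ρ : ZetaZeros.riemannZetaNontrivialZeros,
      (riemannZetaZeroOrder (ρ : ℂ) : ℂ) * (offA τ ρ (u + h) - offA τ ρ u)) (Set.Icc a b) := by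
  have hτ0 : 0 < τ := by linarith
  have hD := decayD0_nonneg
  set K := τ / 2 * Real.exp (τ / 8) * decayD0 with hK
  have hK0 : 0 ≤ K := by positivity
  set R := max (|a| + |h|) (|b| + |h|) with hR
  set c := K * (2 * (1 + R ^ 2)) * 2 with hc
  refine continuousOn_tsum (u := fun ρ : ZetaZeros.riemannZetaNontrivialZeros =>
    c * ((riemannZetaZeroOrder (ρ : ℂ) : ℝ) / (1 + (ρ : ℂ).im ^ 2))) (fun ρ => ?_) ?_ ?_
  · exact (continuous_const.mul (((continuous_offA hτ0 _).comp (continuous_add_const h)).sub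
      (continuous_offA hτ0 _))).continuousOn
  · exact summable_zeroOrder_div_one_add_im_sq.mul_left c
  · intro ρ u hu
    have hm : (0 : ℝ) ≤ riemannZetaZeroOrder (ρ : ℂ) :=
      riemannZetaZeroOrder_nonneg_of_zero (ZetaZeros.riemannZetaNontrivialZeros.zeta_eq_zero ρ.2)
    have hs : ∀ s : ℝ, |s| ≤ R → ‖offA τ ρ s‖ ≤ K * (2 * (1 + R ^ 2)) / (1 + (ρ : ℂ).im ^ 2) := by
      intro s hsR
      refine (norm_offA_le' hτ ρ.2 s).trans ?_
      rw [← hK, div_eq_mul_one_div, mul_div_assoc]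
      refine mul_le_mul_of_nonneg_left ((inv_one_add_sub_sq_le _ s).trans ?_) hK0
      refine div_le_div_of_nonneg_right ?_ (by positivity)
      have : s ^ 2 ≤ R ^ 2 := by rw [← sq_abs s]; exact pow_le_pow_left₀ (abs_nonneg s) hsR 2
      linarith
    have hua : |u| ≤ max |a| |b| := abs_le_max_abs_abs hu.1 hu.2
    have hu1 : |u + h| ≤ R := by
      calc |u + h| ≤ |u| + |h| := abs_add_le u h
        _ ≤ R := by
          rw [hR]; rcases le_max_iff.1 hua with h1 | h1
          · exact le_max_of_le_left (by linarith)
          · exact le_max_of_le_right (by linarith)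
    have hu2 : |u| ≤ R := by
      rw [hR]; rcases le_max_iff.1 hua with h1 | h1
      · exact le_max_of_le_left (by linarith [abs_nonneg h])
      · exact le_max_of_le_right (by linarith [abs_nonneg h])
    rw [norm_mul, Complex.norm_intCast, abs_of_nonneg hm]
    calc (riemannZetaZeroOrder (ρ : ℂ) : ℝ) * ‖offA τ ρ (u + h) - offA τ ρ u‖
        ≤ (riemannZetaZeroOrder (ρ : ℂ) : ℝ) * (K * (2 * (1 + R ^ 2)) / (1 + (ρ : ℂ).im ^ 2) +
            K * (2 * (1 + R ^ 2)) / (1 + (ρ : ℂ).im ^ 2)) :=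
          mul_le_mul_of_nonneg_left ((norm_sub_le _ _).trans (add_le_add (hs _ hu1) (hs _ hu2))) hm
      _ = c * ((riemannZetaZeroOrder (ρ : ℂ) : ℝ) / (1 + (ρ : ℂ).im ^ 2)) := by rw [hc]; ring

/-! ### The remainder terms integrate to `O(T)` -/

/-- On `u ∈ [9T/8, 15T/8]` with `T ≥ 200`, `0 ≤ h ≤ 1`, `1 ≤ τ ≤ log T` and `log(2T+2) + 2 ≤ √T`:
the remainder of `main_pointwise` is at most `3E`. [folklore] -/
theorem remainder_le {E T h τ u : ℝ} (hE : 0 ≤ E) (hT : 200 ≤ T) (hh1 : h ≤ 1) (hτ : 1 ≤ τ)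
    (hτL : τ ≤ Real.log T) (hlog : Real.log (2 * T + 2) + 2 ≤ Real.sqrt T)
    (hu : u ∈ Set.Icc (9 * T / 8) (15 * T / 8)) :
    E * (h * (Real.log (|u| + 2) + 2) / (τ * Real.sqrt T) + h * Real.exp (τ / 8) / (τ * T ^ 2) + h / (τ ^ 3 * T ^ 2)) ≤
      3 * E := by
  have hT0 : 0 < T := by linarith
  have hsq : 0 < Real.sqrt T := Real.sqrt_pos.2 hT0
  have hu0 : 0 ≤ u := by linarith [hu.1]
  have hlogu : Real.log (|u| + 2) ≤ Real.log (2 * T + 2) := by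
    rw [abs_of_nonneg hu0]; exact Real.log_le_log (by linarith) (by linarith [hu.2])
  have hlog0 : 0 ≤ Real.log (|u| + 2) := Real.log_nonneg (by linarith [abs_nonneg u])
  -- term 1
  have t1 : h * (Real.log (|u| + 2) + 2) / (τ * Real.sqrt T) ≤ 1 := by
    rw [div_le_one (by positivity)]
    calc h * (Real.log (|u| + 2) + 2) ≤ 1 * (Real.log (2 * T + 2) + 2) :=
          mul_le_mul hh1 (by linarith) (by positivity) (by norm_num)
      _ ≤ Real.sqrt T := by linarith
      _ ≤ τ * Real.sqrt T := le_mul_of_one_le_left hsq.le hτ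
  -- term 2: `e^{τ/8} ≤ T^{1/8} ≤ T²`
  have t2 : h * Real.exp (τ / 8) / (τ * T ^ 2) ≤ 1 := by
    rw [div_le_one (by positivity)]
    have he : Real.exp (τ / 8) ≤ T ^ 2 := by
      calc Real.exp (τ / 8) ≤ Real.exp (Real.log T) := Real.exp_le_exp.2 (by linarith [Real.log_nonneg (by linarith : (1:ℝ) ≤ T)])
        _ = T := Real.exp_log hT0
        _ ≤ T ^ 2 := by nlinarith
    calc h * Real.exp (τ / 8) ≤ 1 * T ^ 2 := mul_le_mul hh1 he (Real.exp_pos _).le (by norm_num)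
      _ ≤ τ * T ^ 2 := by nlinarith
  have t3 : h / (τ ^ 3 * T ^ 2) ≤ 1 := by
    rw [div_le_one (by positivity)]
    have : (1 : ℝ) ≤ τ ^ 3 * T ^ 2 := one_le_mul_of_one_le_of_one_le (one_le_pow₀ hτ) (by nlinarith)
    linarith
  calc E * _ ≤ E * 3 := mul_le_mul_of_nonneg_left (by linarith) hE
    _ = 3 * E := by ring

/-! ### The integrated inequality -/

/-- **The prime side is dominated, in `L¹(W)`, by the smoothed `S`, the off-line zeros and `O(T)`.**
For `T ≥ 200`, `0 ≤ h ≤ 1`, `1 ≤ τ ≤ log T`, `log(2T+2)+2 ≤ √T`: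
`∫_W |Re Δ𝒱_τ| ≤ 2πg₀(0) ∫_T^{2T} |S(t+h) − S(t)| dt + ∑_ρ m(ρ) ∫_W (|𝒜_ρ(u+h)| + |𝒜_ρ(u)|) du + (9/4) E T`,
`W = [9T/8, 15T/8]`. [cite: Titchmarsh1986, §9.26] -/
theorem integral_primeSide_le {E : ℝ} (hE0 : 0 < E)
    (hE : ∀ (T h τ u : ℝ), 200 ≤ T → 0 ≤ h → h ≤ 1 → 1 ≤ τ →
      u ∈ Set.Icc (9 * T / 8) (15 * T / 8) →
      |(primeV τ (u + h) - primeV τ u).re| ≤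
        |∫ t in T..2 * T, kerDil τ (t - u) * (zetaArgS (t + h) - zetaArgS t)| +
        ‖∑' ρ : ZetaZeros.riemannZetaNontrivialZeros,
            (riemannZetaZeroOrder (ρ : ℂ) : ℂ) * (offA τ ρ (u + h) - offA τ ρ u)‖ +
        E * (h * (Real.log (|u| + 2) + 2) / (τ * Real.sqrt T) + h * Real.exp (τ / 8) / (τ * T ^ 2) + h / (τ ^ 3 * T ^ 2)))
    {T h τ : ℝ} (hT : 200 ≤ T) (hh : 0 ≤ h) (hh1 : h ≤ 1) (hτ : 1 ≤ τ) (hτL : τ ≤ Real.log T)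
    (hlog : Real.log (2 * T + 2) + 2 ≤ Real.sqrt T)
    (hsum : Summable fun ρ : ZetaZeros.riemannZetaNontrivialZeros => (riemannZetaZeroOrder (ρ : ℂ) : ℝ) *
      ∫ u in (9 * T / 8)..(15 * T / 8), (‖offA τ ρ (u + h)‖ + ‖offA τ ρ u‖)) :
    ∫ u in (9 * T / 8)..(15 * T / 8), |(primeV τ (u + h) - primeV τ u).re| ≤
      (2 * π * (g0 0).re) * (∫ t in T..2 * T, |zetaArgS (t + h) - zetaArgS t|) +
      (∑' ρ : ZetaZeros.riemannZetaNontrivialZeros, (riemannZetaZeroOrder (ρ : ℂ) : ℝ) *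
        ∫ u in (9 * T / 8)..(15 * T / 8), (‖offA τ ρ (u + h)‖ + ‖offA τ ρ u‖)) +
      9 / 4 * E * T := by
  have hT0 : 0 < T := by linarith
  have hτ0 : 0 < τ := by linarith
  have hab : 9 * T / 8 ≤ 15 * T / 8 := by linarith
  set a := 9 * T / 8 with ha
  set b := 15 * T / 8 with hb
  -- the three majorants
  set F₁ : ℝ → ℝ := fun u => |∫ t in T..2 * T, kerDil τ (t - u) * (zetaArgS (t + h) - zetaArgS t)| with hF₁
  set F₂ : ℝ → ℝ := fun u => ‖∑' ρ : ZetaZeros.riemannZetaNontrivialZeros,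
      (riemannZetaZeroOrder (ρ : ℂ) : ℂ) * (offA τ ρ (u + h) - offA τ ρ u)‖ with hF₂
  set F₃ : ℝ → ℝ := fun u => E * (h * (Real.log (|u| + 2) + 2) / (τ * Real.sqrt T) +
      h * Real.exp (τ / 8) / (τ * T ^ 2) + h / (τ ^ 3 * T ^ 2)) with hF₃
  have hdS := intervalIntegrable_deltaS h T (2 * T)
  have hc1 : Continuous F₁ := (continuous_conv hτ0 hdS).abs
  have hc2 : ContinuousOn F₂ (Set.Icc a b) := (continuousOn_offLine hτ h a b).norm
  have hc3 : Continuous F₃ := by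
    rw [hF₃]
    refine continuous_const.mul (((Continuous.div_const ?_ _).add continuous_const).add continuous_const)
    refine continuous_const.mul ((Continuous.log (by fun_prop) fun u => ?_).add continuous_const)
    have := abs_nonneg u; linarith
  have hcV : Continuous fun u : ℝ => |(primeV τ (u + h) - primeV τ u).re| :=
    (Complex.continuous_re.comp (((continuous_primeV τ).comp (continuous_add_const h)).sub (continuous_primeV τ))).abs
  have hi1 : IntervalIntegrable F₁ volume a b := hc1.intervalIntegrable _ _
  have hi2 : IntervalIntegrable F₂ volume a b := hc2.intervalIntegrable_of_Icc hab
  have hi3 : IntervalIntegrable F₃ volume a b := hc3.intervalIntegrable _ _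
  -- pointwise domination and integration
  have hmono : ∫ u in a..b, |(primeV τ (u + h) - primeV τ u).re| ≤ ∫ u in a..b, (F₁ u + F₂ u + F₃ u) :=
    intervalIntegral.integral_mono_on hab (hcV.intervalIntegrable _ _) ((hi1.add hi2).add hi3)
      fun u hu => hE T h τ u hT hh hh1 hτ hu
  rw [intervalIntegral.integral_add (hi1.add hi2) hi3, intervalIntegral.integral_add hi1 hi2] at hmono
  -- the three integrals
  have hI1 : ∫ u in a..b, F₁ u ≤ (2 * π * (g0 0).re) * ∫ t in T..2 * T, |zetaArgS (t + h) - zetaArgS t| :=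
    integral_abs_conv_le hτ0 hT0.le hdS hab
  have hI2 : ∫ u in a..b, F₂ u ≤ ∑' ρ : ZetaZeros.riemannZetaNontrivialZeros, (riemannZetaZeroOrder (ρ : ℂ) : ℝ) *
      ∫ u in a..b, (‖offA τ ρ (u + h)‖ + ‖offA τ ρ u‖) := by
    refine integral_le_offLineSum hτ hab hc2 (fun u _ => ?_) hsum
    rw [hF₂]
    refine (norm_tsum_le_tsum_norm (summable_norm_offA_sub hτ u h)).trans ?_
    refine (summable_norm_offA_sub hτ u h).tsum_le_tsum (fun ρ => ?_) ?_
    · have hm : (0 : ℝ) ≤ riemannZetaZeroOrder (ρ : ℂ) :=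
        riemannZetaZeroOrder_nonneg_of_zero (ZetaZeros.riemannZetaNontrivialZeros.zeta_eq_zero ρ.2)
      rw [norm_mul, Complex.norm_intCast, abs_of_nonneg hm]
      exact mul_le_mul_of_nonneg_left (norm_sub_le _ _) hm
    · have hK : 0 ≤ τ / 2 * Real.exp (τ / 8) * decayD0 := by have := decayD0_nonneg; positivity
      have hm' : ∀ ρ : ZetaZeros.riemannZetaNontrivialZeros, (0 : ℝ) ≤ riemannZetaZeroOrder (ρ : ℂ) := fun ρ =>
        riemannZetaZeroOrder_nonneg_of_zero (ZetaZeros.riemannZetaNontrivialZeros.zeta_eq_zero ρ.2)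
      refine Summable.of_nonneg_of_le (fun ρ => mul_nonneg (hm' ρ) (by positivity)) (fun ρ => ?_)
        (((summable_zeroOrder_div_one_add_sub_sq (u + h)).add (summable_zeroOrder_div_one_add_sub_sq u)).mul_left
          (τ / 2 * Real.exp (τ / 8) * decayD0))
      have hm : (0 : ℝ) ≤ riemannZetaZeroOrder (ρ : ℂ) := hm' ρ
      have h1 := norm_offA_le' hτ ρ.2 (u + h)
      have h2 := norm_offA_le' hτ ρ.2 u
      calc (riemannZetaZeroOrder (ρ : ℂ) : ℝ) * (‖offA τ ρ (u + h)‖ + ‖offA τ ρ u‖)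
          ≤ (riemannZetaZeroOrder (ρ : ℂ) : ℝ) * (τ / 2 * Real.exp (τ / 8) * decayD0 / (1 + ((ρ : ℂ).im - (u + h)) ^ 2) +
              τ / 2 * Real.exp (τ / 8) * decayD0 / (1 + ((ρ : ℂ).im - u) ^ 2)) :=
            mul_le_mul_of_nonneg_left (add_le_add h1 h2) hm
        _ = _ := by ring
  have hI3 : ∫ u in a..b, F₃ u ≤ 9 / 4 * E * T := by
    have hle : ∀ u ∈ Set.Icc a b, F₃ u ≤ 3 * E := fun u hu =>
      remainder_le hE0.le hT hh1 hτ hτL hlog hu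
    calc ∫ u in a..b, F₃ u ≤ ∫ u in a..b, (3 * E : ℝ) :=
          intervalIntegral.integral_mono_on hab hi3 (by simp) hle
      _ = 9 / 4 * E * T := by rw [intervalIntegral.integral_const, smul_eq_mul, ha, hb]; ring
  linarith

/-! ### Eventual numerics in `T` -/

/-- `log(2T+2) + 2 ≤ √T` for `T ≥ 4096`. [folklore] -/
theorem log_two_mul_add_two_le_sqrt {T : ℝ} (hT : 4096 ≤ T) : Real.log (2 * T + 2) + 2 ≤ Real.sqrt T := by
  have hT0 : 0 < T := by linarith
  have h1 : Real.log (2 * T + 2) ≤ Real.log 3 + Real.log T := by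
    rw [← Real.log_mul (by norm_num) hT0.ne']; exact Real.log_le_log (by linarith) (by linarith)
  have h3 : Real.log 3 ≤ 2 := by
    have := Real.exp_one_gt_d9
    rw [Real.log_le_iff_le_exp (by norm_num)]
    have h2 : Real.exp 2 = Real.exp 1 ^ 2 := by rw [← Real.exp_nat_mul]; norm_num
    rw [h2]; nlinarith
  have hL : Real.log T ≤ 4 * T ^ (1 / 4 : ℝ) := by
    have := Real.log_le_rpow_div hT0.le (by norm_num : (0:ℝ) < 1 / 4); linarith
  have hx8 : (8 : ℝ) ≤ T ^ (1 / 4 : ℝ) := by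
    have : (4096 : ℝ) ^ (1 / 4 : ℝ) ≤ T ^ (1 / 4 : ℝ) := Real.rpow_le_rpow (by norm_num) hT (by norm_num)
    have e : (4096 : ℝ) ^ (1 / 4 : ℝ) = 8 := by
      rw [show (4096 : ℝ) = 8 ^ (4 : ℝ) by norm_num, ← Real.rpow_mul (by norm_num)]; norm_num
    linarith
  have hsq : Real.sqrt T = (T ^ (1 / 4 : ℝ)) ^ 2 := by
    rw [Real.sqrt_eq_rpow, ← Real.rpow_natCast, ← Real.rpow_mul hT0.le]; norm_num
  rw [hsq]; nlinarith

/-- The thresholds in `T` used in the assembly hold eventually. [folklore] -/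
theorem thresholds_eventually (A₁ A₂ : ℝ) : ∀ᶠ T : ℝ in atTop,
    1856 * (T ^ (1 / 4800 : ℝ) + 1) ^ 2 ≤ 3 * T / 4 ∧ A₁ * (T ^ (1 / 4800 : ℝ) + 1) ≤ 3 * T / 4 ∧
    2400 * (Real.sqrt T * T ^ (1 / 9600 : ℝ)) ≤ T ∧ A₂ ≤ Real.log T := by
  have h1 : ∀ᶠ T : ℝ in atTop, (9899 : ℝ) ≤ T ^ (2399 / 2400 : ℝ) :=
    (tendsto_rpow_atTop (by norm_num)).eventually_ge_atTop _
  have h2 : ∀ᶠ T : ℝ in atTop, (4 / 3 * |A₁| * 2 : ℝ) ≤ T ^ (4799 / 4800 : ℝ) :=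
    (tendsto_rpow_atTop (by norm_num)).eventually_ge_atTop _
  have h3 : ∀ᶠ T : ℝ in atTop, (2400 : ℝ) ≤ T ^ (1 / 2 - 1 / 9600 : ℝ) :=
    (tendsto_rpow_atTop (by norm_num)).eventually_ge_atTop _
  have h4 : ∀ᶠ T : ℝ in atTop, A₂ ≤ Real.log T := Real.tendsto_log_atTop.eventually_ge_atTop _
  have h5 : ∀ᶠ T : ℝ in atTop, (1 : ℝ) ≤ T := eventually_ge_atTop 1
  filter_upwards [h1, h2, h3, h4, h5] with T hT1 hT2 hT3 hT4 hT5
  have hT0 : 0 < T := by linarith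
  set x := T ^ (1 / 4800 : ℝ) with hx
  have hx1 : 1 ≤ x := Real.one_le_rpow hT5 (by norm_num)
  have hx2 : x ^ 2 = T ^ (1 / 2400 : ℝ) := by rw [hx, ← Real.rpow_natCast, ← Real.rpow_mul hT0.le]; norm_num
  have eT1 : T = T ^ (1 / 2400 : ℝ) * T ^ (2399 / 2400 : ℝ) := by rw [← Real.rpow_add hT0]; norm_num
  have eT2 : T = x * T ^ (4799 / 4800 : ℝ) := by rw [hx, ← Real.rpow_add hT0]; norm_num
  have eT3 : T = Real.sqrt T * T ^ (1 / 9600 : ℝ) * T ^ (1 / 2 - 1 / 9600 : ℝ) := by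
    rw [Real.sqrt_eq_rpow, ← Real.rpow_add hT0, ← Real.rpow_add hT0]; norm_num
  refine ⟨?_, ?_, ?_, hT4⟩
  · have hsq : (x + 1) ^ 2 ≤ 4 * x ^ 2 := by nlinarith
    have h0 : 0 ≤ T ^ (1 / 2400 : ℝ) := by positivity
    calc 1856 * (x + 1) ^ 2 ≤ 1856 * (4 * x ^ 2) := by nlinarith
      _ = 7424 * T ^ (1 / 2400 : ℝ) := by rw [hx2]; ring
      _ ≤ 3 / 4 * (T ^ (1 / 2400 : ℝ) * 9899) := by nlinarith
      _ ≤ 3 / 4 * (T ^ (1 / 2400 : ℝ) * T ^ (2399 / 2400 : ℝ)) := by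
          exact mul_le_mul_of_nonneg_left (mul_le_mul_of_nonneg_left hT1 h0) (by norm_num)
      _ = 3 * T / 4 := by rw [← eT1]; ring
  · have h0 : 0 ≤ x := by linarith
    calc A₁ * (x + 1) ≤ |A₁| * (2 * x) := by
          have := le_abs_self A₁; have := abs_nonneg A₁; nlinarith
      _ = 3 / 4 * (x * (4 / 3 * |A₁| * 2)) := by ring
      _ ≤ 3 / 4 * (x * T ^ (4799 / 4800 : ℝ)) := mul_le_mul_of_nonneg_left (mul_le_mul_of_nonneg_left hT2 h0) (by norm_num)
      _ = 3 * T / 4 := by rw [← eT2]; ring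
  · have h0 : 0 ≤ Real.sqrt T * T ^ (1 / 9600 : ℝ) := by positivity
    calc 2400 * (Real.sqrt T * T ^ (1 / 9600 : ℝ)) = Real.sqrt T * T ^ (1 / 9600 : ℝ) * 2400 := by ring
      _ ≤ Real.sqrt T * T ^ (1 / 9600 : ℝ) * T ^ (1 / 2 - 1 / 9600 : ℝ) := mul_le_mul_of_nonneg_left hT3 h0
      _ = T := eT3.symm

end Literature.NumberTheory.LFunctions.SelbergDelta

namespace Literature.NumberTheory.LFunctions

open SelbergDelta SelbergOmega RudnickSarnakN

/-! ### Selberg's first-moment bound and the small gaps -/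

set_option maxHeartbeats 1600000 in
/-- **Selberg's bound `∫_T^{2T} |S(t+h) − S(t)| dt ≫ T` at the shift scale `h ≍ M/log T`**
(Titchmarsh §9.26): there are `M ≥ 1`, `c₁ > 0` and `T₀` such that
`∫_T^{2T} |S(t+h) − S(t)| dt ≥ c₁ T` for `T ≥ T₀` and `2πM ≤ h log T ≤ 4πM`.
[cite: Titchmarsh1986, §9.26] -/
theorem abs_moment_deltaS_lower : ∃ M : ℕ, 1 ≤ M ∧ ∃ c₁ : ℝ, 0 < c₁ ∧ ∃ T₀ : ℝ, ∀ T : ℝ, T₀ ≤ T → ∀ h : ℝ,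
    2 * π * M ≤ h * Real.log T → h * Real.log T ≤ 4 * π * M →
      c₁ * T ≤ ∫ t in T..2 * T, |zetaArgS (t + h) - zetaArgS t| := by
  obtain ⟨E, hE0, hE⟩ := main_pointwise
  obtain ⟨Coff, hCoff0, hoff⟩ := exists_offLine_L1_bound
  obtain ⟨cn, T₁, hcn, hnear⟩ := nearSum_le_linear
  obtain ⟨ε₀, B, Cps, hε₀, hB, hCps, hprime⟩ := primeSide_lower
  have hg := g0_zero_re_pos
  have hD := decayD0_nonneg
  have hbM := bumpMass_pos
  set g := (g0 0).re with hgdef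
  -- the constants and the shift scale `M`
  set K := Cps + 3 * E + 4 / 3 * (2 * π * decayD0 * cn + Coff + 2 * π * g) with hK
  have hK0 : 0 ≤ K := by positivity
  set X₀ := (400 * K ^ 2 + B) / (2 * g ^ 2) with hX₀
  have hX₀0 : 0 ≤ X₀ := by positivity
  set M : ℕ := ⌈1200 / (2 * π * ε₀) * Real.exp X₀⌉₊ + 1 with hMdef
  have hM1 : 1 ≤ M := by omega
  have hMR : 1200 / (2 * π * ε₀) * Real.exp X₀ ≤ M := by
    have := Nat.le_ceil (1200 / (2 * π * ε₀) * Real.exp X₀)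
    rw [hMdef]; push_cast; linarith
  have hMpos : (0 : ℝ) < M := by exact_mod_cast hM1
  -- `ε₀ · 2πM/1200 ≥ e^{X₀} ≥ 1`
  have hkey : Real.exp X₀ ≤ ε₀ * (2 * π * M / 1200) := by
    have := mul_le_mul_of_nonneg_left hMR (by positivity : (0:ℝ) ≤ 2 * π * ε₀ / 1200)
    calc Real.exp X₀ = 2 * π * ε₀ / 1200 * (1200 / (2 * π * ε₀) * Real.exp X₀) := by
          field_simp
      _ ≤ 2 * π * ε₀ / 1200 * M := this
      _ = ε₀ * (2 * π * M / 1200) := by ring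
  have hkey1 : 1 ≤ ε₀ * (2 * π * M / 1200) := le_trans (Real.one_le_exp hX₀0) hkey
  -- `Λ ≥ K`
  have hΛ : 20 * K ≤ Real.sqrt (2 * g ^ 2 * Real.log (ε₀ * (2 * π * M / 1200)) - B) := by
    have hlog : X₀ ≤ Real.log (ε₀ * (2 * π * M / 1200)) := by
      rw [← Real.log_exp X₀]; exact Real.log_le_log (Real.exp_pos _) hkey
    have h1 : 400 * K ^ 2 ≤ 2 * g ^ 2 * Real.log (ε₀ * (2 * π * M / 1200)) - B := by
      have : 2 * g ^ 2 * X₀ = 400 * K ^ 2 + B := by rw [hX₀]; field_simp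
      nlinarith [mul_le_mul_of_nonneg_left hlog (by positivity : (0:ℝ) ≤ 2 * g ^ 2)]
    calc 20 * K = Real.sqrt ((20 * K) ^ 2) := (Real.sqrt_sq (by positivity)).symm
      _ ≤ _ := Real.sqrt_le_sqrt (by nlinarith)
  -- thresholds in `T`
  set A₂ := max 1200 (max (4 * π * M) (8 * π * M * (|Real.log (4 * π * ε₀ * M / 1200)| + 1))) with hA₂
  have hev := (thresholds_eventually (60000 * bumpMass ^ 2) A₂).and
    ((eventually_ge_atTop (max T₁ 4096)))
  obtain ⟨T₀, hT₀⟩ := Filter.eventually_atTop.1 hev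
  refine ⟨M, hM1, 1, one_pos, T₀, ?_⟩
  intro T hT h hh1 hh2
  obtain ⟨⟨ht7, ht8, ht9, htL⟩, hTmax⟩ := hT₀ T hT
  have hT1 : T₁ ≤ T := le_trans (le_max_left _ _) hTmax
  have hT4096 : 4096 ≤ T := le_trans (le_max_right _ _) hTmax
  have hT200 : (200 : ℝ) ≤ T := by linarith
  have hT0 : 0 < T := by linarith
  set L := Real.log T with hLdef
  have hL1200 : 1200 ≤ L := le_trans (le_max_left _ _) htL
  have hL4 : 4 * π * M ≤ L := le_trans (le_trans (le_max_left _ _) (le_max_right _ _)) htL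
  have hL8 : 8 * π * M * (|Real.log (4 * π * ε₀ * M / 1200)| + 1) ≤ L :=
    le_trans (le_trans (le_max_right _ _) (le_max_right _ _)) htL
  have hLpos : 0 < L := by linarith
  -- the shift
  have hh0 : 0 < h := by
    by_contra hle
    push Not at hle
    have h1 : h * L ≤ 0 := mul_nonpos_of_nonpos_of_nonneg hle hLpos.le
    have h2 : (0 : ℝ) < 2 * π * M := by positivity
    linarith
  have hhle : h ≤ 1 := by
    by_contra hgt
    push Not at hgt
    have : L < h * L := by nlinarith
    linarith
  set τ := L / 1200 with hτdef
  have hτ1 : 1 ≤ τ := by rw [hτdef, le_div_iff₀ (by norm_num)]; linarith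
  have hτ0 : 0 < τ := by linarith
  have hτL : τ ≤ L := by rw [hτdef]; linarith
  -- `ε₀ τ h ∈ [ε₀·2πM/1200, 4πε₀M/1200]`
  have heq : ε₀ * τ * h = ε₀ * (h * L / 1200) := by rw [hτdef]; ring
  have hth_lo : ε₀ * (2 * π * M / 1200) ≤ ε₀ * τ * h := by
    rw [heq]
    exact mul_le_mul_of_nonneg_left (div_le_div_of_nonneg_right hh1 (by norm_num)) hε₀.le
  have hth_hi : ε₀ * τ * h ≤ 4 * π * ε₀ * M / 1200 := by
    rw [heq]
    have := mul_le_mul_of_nonneg_left (div_le_div_of_nonneg_right hh2 (by norm_num : (0:ℝ) ≤ 1200)) hε₀.le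
    calc ε₀ * (h * L / 1200) ≤ ε₀ * (4 * π * M / 1200) := this
      _ = 4 * π * ε₀ * M / 1200 := by ring
  have hPQ : 1 ≤ ε₀ * τ * h := hkey1.trans hth_lo
  have hpos : 0 < ε₀ * τ * h := by linarith
  have hhlog : 2 * h * Real.log (ε₀ * τ * h) ≤ 1 := by
    have hlogle : Real.log (ε₀ * τ * h) ≤ |Real.log (4 * π * ε₀ * M / 1200)| :=
      (Real.log_le_log hpos hth_hi).trans (le_abs_self _)
    have hlog0 : 0 ≤ Real.log (ε₀ * τ * h) := Real.log_nonneg hPQ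
    have h2h : 2 * h ≤ 8 * π * M / L := by rw [le_div_iff₀ hLpos]; linarith
    calc 2 * h * Real.log (ε₀ * τ * h) ≤ 8 * π * M / L * |Real.log (4 * π * ε₀ * M / 1200)| :=
          mul_le_mul h2h hlogle hlog0 (by positivity)
      _ ≤ 1 := by
          rw [div_mul_eq_mul_div, div_le_one hLpos]
          have : 0 ≤ 8 * π * (M : ℝ) := by positivity
          nlinarith
  -- window numerics
  have hN : (nCut τ : ℝ) ≤ T ^ (1 / 4800 : ℝ) := by
    unfold nCut
    refine (Nat.floor_le (Real.exp_pos _).le).trans (le_of_eq ?_)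
    rw [hτdef, Real.rpow_def_of_pos hT0, hLdef]
    congr 1; ring
  have eW : 15 * T / 8 - 9 * T / 8 = 3 * T / 4 := by ring
  have hW1 : 1856 * ((nCut τ : ℝ) + 1) ^ 2 ≤ 15 * T / 8 - 9 * T / 8 := by
    have : ((nCut τ : ℝ) + 1) ^ 2 ≤ (T ^ (1 / 4800 : ℝ) + 1) ^ 2 := pow_le_pow_left₀ (by positivity) (by linarith) 2
    rw [eW]; linarith
  have hW2 : 60000 * bumpMass ^ 2 * ((nCut τ : ℝ) + 1) ≤ 15 * T / 8 - 9 * T / 8 := by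
    rw [eW]
    exact le_trans (mul_le_mul_of_nonneg_left (by linarith) (by positivity)) ht8
  -- the prime side from below
  have hP := hprime τ h (9 * T / 8) (15 * T / 8) hh0 hhle hτ0 hPQ hhlog (by positivity) (by linarith) (by linarith)
    hW1 hW2
  have hΛh : 20 * K ≤ Real.sqrt (2 * g ^ 2 * Real.log (ε₀ * τ * h) - B) := by
    refine hΛ.trans (Real.sqrt_le_sqrt ?_)
    have := Real.log_le_log (by positivity : 0 < ε₀ * (2 * π * M / 1200)) hth_lo
    nlinarith [sq_nonneg g]
  -- the prime side from above
  obtain ⟨hsum, hoffle⟩ := hoff T h τ hT200 hh0.le hhle hτ1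
  have hU := integral_primeSide_le hE0 hE hT200 hh0.le hhle hτ1 hτL (log_two_mul_add_two_le_sqrt hT4096) hsum
  have hnearT := hnear T hT1 τ (le_of_eq hτdef)
  have hsec : Coff * Real.sqrt T * Real.exp (τ / 8) * (Real.log T + 3) / τ ≤ Coff * T := by
    have he : Real.exp (τ / 8) = T ^ (1 / 9600 : ℝ) := by
      rw [hτdef, Real.rpow_def_of_pos hT0, hLdef]; congr 1; ring
    rw [he]
    have hL3 : (Real.log T + 3) / τ ≤ 2400 := by
      rw [div_le_iff₀ hτ0, hτdef, ← hLdef]; linarith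
    have h0 : 0 ≤ Coff * (Real.sqrt T * T ^ (1 / 9600 : ℝ)) := by positivity
    calc Coff * Real.sqrt T * T ^ (1 / 9600 : ℝ) * (Real.log T + 3) / τ
        = Coff * (Real.sqrt T * T ^ (1 / 9600 : ℝ)) * ((Real.log T + 3) / τ) := by ring
      _ ≤ Coff * (Real.sqrt T * T ^ (1 / 9600 : ℝ)) * 2400 := mul_le_mul_of_nonneg_left hL3 h0
      _ = Coff * (2400 * (Real.sqrt T * T ^ (1 / 9600 : ℝ))) := by ring
      _ ≤ Coff * T := mul_le_mul_of_nonneg_left ht9 hCoff0.le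
  have hoff2 := hoffle.trans (add_le_add (mul_le_mul_of_nonneg_left hnearT (by positivity : (0:ℝ) ≤ 2 * π * decayD0)) hsec)
  -- combine
  set s := Real.sqrt (2 * g ^ 2 * Real.log (ε₀ * τ * h) - B) with hs
  have h2 : 3 / 4 * T * K ≤ 3 / 4 * T * (s / 20) := mul_le_mul_of_nonneg_left (by linarith) (by positivity)
  have h3 : 3 / 4 * T * K = 3 / 4 * T * Cps + 9 / 4 * E * T + (2 * π * decayD0 * cn * T + Coff * T + 2 * π * g * T) := by
    rw [hK]; ring
  have key : 2 * π * g * T ≤ 2 * π * g * ∫ t in T..2 * T, |zetaArgS (t + h) - zetaArgS t| := by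
    linarith
  rw [one_mul]
  exact le_of_mul_le_mul_left key (by positivity)

/-- **Selberg–Fujii small gaps** (Titchmarsh (9.25.6)): a positive proportion of consecutive
ordinates of the zeros of `ζ` are closer than `μ < 1` times the average spacing `2π/log γ_n`.
[cite: Titchmarsh1986, §9.25 (9.25.6), §9.26] -/
theorem selberg_fujii_small_gaps_holds : selberg_fujii_small_gaps :=
  selberg_fujii_small_gaps_of_abs_moment abs_moment_deltaS_lower

end Literature.NumberTheory.LFunctions
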